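import Summits.BirchSwinnertonDyer.BirchSwinnertonDyer.Theorems.RamifiedHeegnerPairLeafPartnerGenusLabelB2
import Summits.BirchSwinnertonDyer.Rank1Residual.X11b.RingClassFieldConj
import Literature.NumberTheory.EllipticCurves.RingClassFieldConjugation
import HarnessLib

/-!
# Crux U₁ `LeafRankOneUpperAtThree` (stmt-BirchSwinnertonDyer-26022) ∕ U₀ (26024), line `partnerdescent` — partner kernel part 18:
# label (B3) of the descended family — COMPLEX CONJUGATION: `τ_m·D_m − ε_W·σ″·D_m` is torsion, `ε_W = −ε_V·χ(σ′)`

HONEST FRAMING (lead prover `bsd-line-rhp-p2` g58, explicit-unit seat, cell `bsd-wall`): a SUPPORT file (`--supports 26022 --as helper`)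
for the registered stub (DISPLAY-L) `stub_partnerGenusDisplayLabelledAtThree`. It proves NO stub and closes NO item; BSD is proved for no
curve. Theorems only; no definition, no named fact, no `sorry`.

WHAT. The (B3) conjunct of `ShimuraWalk.LabelsAt` (Gross Prop. 5.3: `τ y − ε σ′ y` torsion) at a level `m` for the descended family
`ys(m) = c·D_m`, `D_m↑K[3m] = ψ_θ((1 − σ_m)·y(3m))`, from the (B3χ) clause of the typed fact `shimuraCurve_heegnerSystem_genusThree` AT
level `3m`: `τ̃ y − ε σ′ y` torsion for the complex conjugation `τ̃` of `K[3m]`, with the SIGN `χ(σ′) = σ′θ/θ = u` handed in (on the line it is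
the constant `χ(σ₃)` of the pinned `σ₃`, read through the pinning clause). THE SIGN LEDGER: `τ̃ θ = −θ` (`θ² = −3`, so `θ ∈ iℝ`:
`conj_eq_neg_of_sq_eq_neg_three`), hence `τ̃·ψ_θ z = −ψ_θ(τ̃ z)` (part 10); `τ̃ σ = σ τ̃` (dihedral relation `τ̃στ̃⁻¹ = σ⁻¹`, tree
`mul_mul_inv_eq_inv_of_not_mem_ringClassGal`, and `σ² = 1`), so `τ̃ z = ε σ′ z + (torsion)` (`σσ′ = σ′σ`, tree `commute_of_mem_ringClassGal`);
`ψ_θ(σ′ z) = u·σ′·ψ_θ z` (part 10 sign rule); descend along the injective, `res`-equivariant inclusion (part 16): with `σ″ := res σ′`,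
**`τ_m·(c•D_m) − (−ε·u)·σ″·(c•D_m)` is torsion** (`labelB3_of_descents`) — VERBATIM the (B3) clause for `ys(m)`, `ε_W = −ε u`.
[cite: GrossLMS1991, §5 (5.1)–(5.2), Prop. 5.3 and proof of Prop. 5.4 (τστ⁻¹ = σ⁻¹)] [cite: BertoliniDarmon1996, Prop. 2.6]
[cite: Cox2013, §9.A Lemma 9.3] [cite: SilvermanAEC2009, X.5 Cor. 5.4 (iii)]
presearch: as parts 14–17 (sign of the genus-descended family under complex conjugation: `ε_W = −ε_V`-type bookkeeping is not printed; tree: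
X11b `RingClassFieldConj`, `RingClassFieldConjugation`, `RingClassFieldAbelian`); nothing restated.
-/

set_option linter.dupNamespace false
set_option autoImplicit false

noncomputable section

open scoped Classical ComplexConjugate

namespace Summit.BirchSwinnertonDyer.BirchSwinnertonDyer.Theorems.LeafPartnerGenusLabelB3

open WeierstrassCurve NumberField Literature.NumberTheory.EllipticCurves
  Literature.NumberTheory.EllipticCurves.RingClassField
  Summit.BirchSwinnertonDyer.Rank1Residual.X11b.RingClassTower
  Summit.BirchSwinnertonDyer.Rank1Residual.X11b.RingClassConj
  Summit.BirchSwinnertonDyer.BirchSwinnertonDyer.Theorems.LeafPartnerGenusTransport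
  Summit.BirchSwinnertonDyer.BirchSwinnertonDyer.Theorems.LeafPartnerGenusBottom
  Summit.BirchSwinnertonDyer.BirchSwinnertonDyer.Theorems.LeafPartnerGenusLift
  Summit.BirchSwinnertonDyer.BirchSwinnertonDyer.Theorems.LeafPartnerGenusLabelB2

variable {K : Type} [Field K] [NumberField K]

/-! ## §1 Complex conjugation negates `√−3` -/

/-- A complex square root of `−3` is purely imaginary: `conj z = −z`. [folklore] -/
theorem conj_eq_neg_of_sq_eq_neg_three {z : ℂ} (hz : z ^ 2 = -3) : conj z = -z := by
  have hre : (z ^ 2).re = -3 := by rw [hz]; norm_num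
  have him : (z ^ 2).im = 0 := by rw [hz]; norm_num
  rw [sq, Complex.mul_re] at hre
  rw [sq, Complex.mul_im] at him
  have h0 : z.re = 0 := by
    by_contra h
    have him0 : z.im = 0 := by
      have : 2 * (z.re * z.im) = 0 := by linarith
      rcases mul_eq_zero.mp this with h2 | h2
      · norm_num at h2
      · rcases mul_eq_zero.mp h2 with h3 | h3
        · exact absurd h3 h
        · exact h3
    rw [him0, mul_zero, sub_zero] at hre
    nlinarith [mul_self_nonneg z.re]
  apply Complex.ext
  · simp [h0]
  · simp

/-- **The complex conjugation of `K[n]` negates `θ`** (`θ ∈ K[n]`, `θ² = −3`). [folklore] -/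
theorem conj_apply_theta {ι : K →+* ℂ} {n : ℕ} {τ : ringClassField K ι n ≃ₐ[ℚ] ringClassField K ι n}
    (hτ : ∀ x : ringClassField K ι n, ((τ x : ringClassField K ι n) : ℂ) = conj (x : ℂ))
    {θ : ringClassField K ι n} (hθ2 : θ ^ 2 = algebraMap ℚ (ringClassField K ι n) (-3)) : τ θ = -θ := by
  apply Subtype.ext
  have hθC : ((θ : ringClassField K ι n) : ℂ) ^ 2 = -3 := by
    have h := congrArg (fun x : ringClassField K ι n => (x : ℂ)) hθ2
    simp only [SubmonoidClass.coe_pow] at h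
    rw [h, eq_ratCast]; push_cast; rfl
  rw [hτ, conj_eq_neg_of_sq_eq_neg_three hθC]; rfl

/-! ## §2 The inclusion intertwines the conjugations and the two `res`-actions -/

/-- **`(τ_m · D)↑ = τ̃ · (D↑)`**: the inclusion `K[m] → K[n]` intertwines the complex conjugations of `K[m]` and `K[n]` (both act as `conj`
on the complex numbers). [cite: GrossLMS1991, §1 (all fields inside ℂ), §5] -/
theorem map_inclusion_pointGalHom_conj (W : WeierstrassCurve ℚ) (ι : K →+* ℂ) {m n : ℕ}
    (hle : ringClassField K ι m ≤ ringClassField K ι n)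
    {τm : ringClassField K ι m ≃ₐ[ℚ] ringClassField K ι m} (hτm : ∀ x, ((τm x : ringClassField K ι m) : ℂ) = conj (x : ℂ))
    {τn : ringClassField K ι n ≃ₐ[ℚ] ringClassField K ι n} (hτn : ∀ x, ((τn x : ringClassField K ι n) : ℂ) = conj (x : ℂ))
    (D : (W.baseChange (ringClassField K ι m)).toAffine.Point) :
    Affine.Point.map ((RingClassField.inclusion ι hle).restrictScalars ℚ) (pointGalHom W (ringClassField K ι m) τm D) =
      pointGalHom W (ringClassField K ι n) τn (Affine.Point.map ((RingClassField.inclusion ι hle).restrictScalars ℚ) D) := by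
  have hFG : ((RingClassField.inclusion ι hle).restrictScalars ℚ).comp (τm : ringClassField K ι m →ₐ[ℚ] ringClassField K ι m) =
      (τn : ringClassField K ι n →ₐ[ℚ] ringClassField K ι n).comp ((RingClassField.inclusion ι hle).restrictScalars ℚ) := by
    refine AlgHom.ext fun x => Subtype.ext ?_
    change ((RingClassField.inclusion ι hle (τm x) : ringClassField K ι n) : ℂ) =
      ((τn (RingClassField.inclusion ι hle x) : ringClassField K ι n) : ℂ)
    rw [RingClassField.coe_inclusion, hτm, hτn, RingClassField.coe_inclusion]
  rw [pointGalHom_apply, pointGalHom_apply, Affine.Point.map_map, Affine.Point.map_map, hFG]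

/-- **`(res g · D)↑ = g · (D↑)`** for `g ∈ Gal(K[3m]/K)` (plain equivariance of the inclusion, `pointGalHom_restrictHom_map_inclusion` with
the identity restriction at the top). [cite: GrossLMS1991, §3 (p. 216), §4 (4.1)] -/
theorem map_inclusion_pointGalHom_res (W : WeierstrassCurve ℚ) (hK : IsImaginaryQuadratic K) (ι : K →+* ℂ) {m : ℕ} (hm : m ≠ 0)
    (hle : ringClassField K ι m ≤ ringClassField K ι (3 * m))
    {res : ringClassGal ι (3 * m) →* (ringClassField K ι m ≃ₐ[ℚ] ringClassField K ι m)}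
    (hres : ∀ (g : ringClassGal ι (3 * m)) (x : ringClassField K ι m) (y : ringClassField K ι (3 * m)),
      (x : ℂ) = (y : ℂ) → ((res g x : ringClassField K ι m) : ℂ) =
        (((g : ringClassField K ι (3 * m) ≃ₐ[ℚ] ringClassField K ι (3 * m)) y : ringClassField K ι (3 * m)) : ℂ))
    (g : ringClassGal ι (3 * m)) (D : (W.baseChange (ringClassField K ι m)).toAffine.Point) :
    Affine.Point.map ((RingClassField.inclusion ι hle).restrictScalars ℚ) (pointGalHom W (ringClassField K ι m) (res g) D) =
      pointGalHom W (ringClassField K ι (3 * m)) (g : ringClassField K ι (3 * m) ≃ₐ[ℚ] ringClassField K ι (3 * m))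
        (Affine.Point.map ((RingClassField.inclusion ι hle).restrictScalars ℚ) D) := by
  have hn : 3 * m ≠ 0 := mul_ne_zero three_ne_zero hm
  letI : Algebra K ℂ := ι.toAlgebra
  have hid : ∀ (g : ringClassGal ι (3 * m)) (x : ringClassField K ι (3 * m)) (y : ringClassField K ι (3 * m)),
      (x : ℂ) = (y : ℂ) → (((ringClassGal ι (3 * m)).subtype g x : ringClassField K ι (3 * m)) : ℂ) =
        (((g : ringClassField K ι (3 * m) ≃ₐ[ℚ] ringClassField K ι (3 * m)) y : ringClassField K ι (3 * m)) : ℂ) := by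
    intro g x y hxy
    have : x = y := Subtype.ext hxy
    rw [this]; rfl
  exact (pointGalHom_restrictHom_map_inclusion (W := W) hK ι (dvd_mul_left m 3) (dvd_refl (3 * m)) hn hle hid hres g D).symm

/-! ## §3 Bridging `ψ_θ` to the point-group structure in scope (cf. part 17 §2) -/

section Bridge

variable (W : WeierstrassCurve ℚ) {W₁ : WeierstrassCurve ℚ} [W₁.IsCharNeTwoNF] (C₁ : VariableChange ℚ) (hC₁ : C₁ • W = W₁)
  {V : WeierstrassCurve ℚ} (CV : VariableChange ℚ) (hV : CV • W₁.quadraticTwist (-3) = V)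
  {L : Type} [Field L] [Algebra ℚ L] {θ : L}

/-- `ψ_θ(z₁ + z₂) = ψ_θ z₁ + ψ_θ z₂` for the point-group structure in scope. [folklore] -/
theorem genusTransport_add [d : DecidableEq L] (hθ : θ ^ 2 = algebraMap ℚ L (-3)) (z₁ z₂ : (V.baseChange L).toAffine.Point) :
    genusTransport W C₁ hC₁ CV hV hθ (z₁ + z₂) = genusTransport W C₁ hC₁ CV hV hθ z₁ + genusTransport W C₁ hC₁ CV hV hθ z₂ := by
  obtain rfl : d = fun a b => Classical.propDecidable (a = b) := Subsingleton.elim _ _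
  exact map_add _ z₁ z₂

/-- `ψ_θ(z)` has finite order iff `z` does, for the point-group structure in scope (part 10 `isOfFinAddOrder_genusTransport_iff`). [folklore] -/
theorem isOfFinAddOrder_genusTransport_iff' [d : DecidableEq L] (hθ : θ ^ 2 = algebraMap ℚ L (-3)) (z : (V.baseChange L).toAffine.Point) :
    IsOfFinAddOrder (genusTransport W C₁ hC₁ CV hV hθ z) ↔ IsOfFinAddOrder z := by
  obtain rfl : d = fun a b => Classical.propDecidable (a = b) := Subsingleton.elim _ _
  exact isOfFinAddOrder_genusTransport_iff W C₁ hC₁ CV hV hθ z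

end Bridge

/-! ## §4 Label (B3) at level `m` -/

section B3

variable (W : WeierstrassCurve ℚ) {W₁ : WeierstrassCurve ℚ} [W₁.IsCharNeTwoNF] (C₁ : VariableChange ℚ) (hC₁ : C₁ • W = W₁)
  {V : WeierstrassCurve ℚ} (CV : VariableChange ℚ) (hV : CV • W₁.quadraticTwist (-3) = V)

/-- **Label (B3) for the descended family at level `m`.** Data: `3m`-level genus involution `σ` (`σ ∈ Gal(K[3m]/K[m])`, `σ² = 1`; that it
negates `θ` is not even needed here),
the restriction `res : Gal(K[3m]/K) → Aut(K[m])`, `y ∈ V(K[3m])`, the descent `D ∈ W(K[m])` of `ψ_θ(y − σ y)`, a sign `ε`, a unit `u`, and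
the (B3χ) clause of the fact at level `3m` WITH ITS SIGN READ: for every complex conjugation `τ̃` of `K[3m]` some `σ′ ∈ Gal(K[3m]/K)` with
`χ(σ′) = u` has `τ̃ y − ε σ′ y` torsion. CONCLUSION: for every complex conjugation `τ_m` of `K[m]` and every integer `c` there is
`σ″ ∈ Gal(K[m]/K)` with `τ_m (c • D) − (−ε u) • σ″ (c • D)` of finite order — the (B3) clause of `ShimuraWalk.LabelsAt` for `ys(m) = c • D`,
`ε_W = −ε·u`. [cite: GrossLMS1991, §5 Prop. 5.3, proof of Prop. 5.4] [cite: BertoliniDarmon1996, Prop. 2.6] -/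
theorem labelB3_of_descents (hK : IsImaginaryQuadratic K) (ι : K →+* ℂ) {m : ℕ} (hm : m ≠ 0)
    (hle : ringClassField K ι m ≤ ringClassField K ι (3 * m))
    {res : ringClassGal ι (3 * m) →* (ringClassField K ι m ≃ₐ[ℚ] ringClassField K ι m)}
    (hres : ∀ (g : ringClassGal ι (3 * m)) (x : ringClassField K ι m) (y : ringClassField K ι (3 * m)),
      (x : ℂ) = (y : ℂ) → ((res g x : ringClassField K ι m) : ℂ) =
        (((g : ringClassField K ι (3 * m) ≃ₐ[ℚ] ringClassField K ι (3 * m)) y : ringClassField K ι (3 * m)) : ℂ))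
    {σ : ringClassField K ι (3 * m) ≃ₐ[ℚ] ringClassField K ι (3 * m)} (hσ : σ ∈ ringClassGalOver ι (3 * m) m) (hσσ : σ * σ = 1)
    {θ : ringClassField K ι (3 * m)} (hθ2 : θ ^ 2 = algebraMap ℚ (ringClassField K ι (3 * m)) (-3))
    (y : (V.baseChange (ringClassField K ι (3 * m))).toAffine.Point) (D : (W.baseChange (ringClassField K ι m)).toAffine.Point)
    (hD : Affine.Point.map ((RingClassField.inclusion ι hle).restrictScalars ℚ) D =
      genusTransport W C₁ hC₁ CV hV hθ2 (y - pointGalHom V (ringClassField K ι (3 * m)) σ y))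
    (ε : ℤ) (u : ℤˣ)
    (hB3 : ∀ τ : ringClassField K ι (3 * m) ≃ₐ[ℚ] ringClassField K ι (3 * m),
      (∀ x : ringClassField K ι (3 * m), ((τ x : ringClassField K ι (3 * m)) : ℂ) = conj (x : ℂ)) →
      ∃ σ' ∈ ringClassGal ι (3 * m), genusSign θ σ' = u ∧
        IsOfFinAddOrder (pointGalHom V (ringClassField K ι (3 * m)) τ y - ε • pointGalHom V (ringClassField K ι (3 * m)) σ' y))
    (τm : ringClassField K ι m ≃ₐ[ℚ] ringClassField K ι m) (hτm : ∀ x : ringClassField K ι m, ((τm x : ringClassField K ι m) : ℂ) = conj (x : ℂ))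
    (c : ℤ) :
    ∃ σ'' ∈ ringClassGal ι m,
      IsOfFinAddOrder (pointGalHom W (ringClassField K ι m) τm (c • D) -
        (-ε * (u : ℤ)) • pointGalHom W (ringClassField K ι m) σ'' (c • D)) := by
  have hn : 3 * m ≠ 0 := mul_ne_zero three_ne_zero hm
  -- the complex conjugation of `K[3m]` and the (B3χ) datum
  obtain ⟨τt, hτt⟩ := exists_conj_algEquiv hK ι hn
  obtain ⟨σ', hσ'G, hsgn, htor⟩ := hB3 τt hτt
  have hτtG : τt ∉ ringClassGal ι (3 * m) := conj_not_mem_ringClassGal hτt hK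
  have hσG : σ ∈ ringClassGal ι (3 * m) := ringClassGalOver_le_ringClassGal ι (3 * m) m hσ
  have hτθ : τt θ = -θ := conj_apply_theta hτt hθ2
  have hθ : θ ≠ -θ := ne_neg_of_ne_zero (theta_ne_zero hθ2)
  -- group identities: `τ̃ σ = σ τ̃` (`τ̃στ̃⁻¹ = σ⁻¹ = σ`), `σ σ′ = σ′ σ`
  have hσinv : σ⁻¹ = σ := inv_eq_of_mul_eq_one_right hσσ
  have hτσ : τt * σ = σ * τt := by
    have h := mul_mul_inv_eq_inv_of_not_mem_ringClassGal hK ι hn hτtG hσG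
    rw [hσinv] at h
    calc τt * σ = τt * σ * τt⁻¹ * τt := by group
      _ = σ * τt := by rw [h]
  have hσσ' : σ * σ' = σ' * σ := commute_of_mem_ringClassGal hK hn hσG hσ'G
  have hcomp : ∀ (a b : (ringClassField K ι (3 * m)) ≃ₐ[ℚ] (ringClassField K ι (3 * m))) (P : (V.baseChange (ringClassField K ι (3 * m))).toAffine.Point),
      pointGalHom V (ringClassField K ι (3 * m)) a (pointGalHom V (ringClassField K ι (3 * m)) b P) = pointGalHom V (ringClassField K ι (3 * m)) (a * b) P := fun a b P => by
    rw [map_mul]; rfl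
  -- `τ̃ z = ε • σ′ z + (t − σ t)` with `z = y − σ y`, `t = τ̃ y − ε σ′ y`
  have hτz : pointGalHom V (ringClassField K ι (3 * m)) τt (y - pointGalHom V (ringClassField K ι (3 * m)) σ y) =
      ε • pointGalHom V (ringClassField K ι (3 * m)) σ' (y - pointGalHom V (ringClassField K ι (3 * m)) σ y) +
        ((pointGalHom V (ringClassField K ι (3 * m)) τt y - ε • pointGalHom V (ringClassField K ι (3 * m)) σ' y) -
          pointGalHom V (ringClassField K ι (3 * m)) σ (pointGalHom V (ringClassField K ι (3 * m)) τt y - ε • pointGalHom V (ringClassField K ι (3 * m)) σ' y)) := by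
    have h1 : pointGalHom V (ringClassField K ι (3 * m)) τt (pointGalHom V (ringClassField K ι (3 * m)) σ y) = pointGalHom V (ringClassField K ι (3 * m)) σ (pointGalHom V (ringClassField K ι (3 * m)) τt y) := by
      rw [hcomp, hcomp, hτσ]
    have h2 : pointGalHom V (ringClassField K ι (3 * m)) σ (pointGalHom V (ringClassField K ι (3 * m)) σ' y) = pointGalHom V (ringClassField K ι (3 * m)) σ' (pointGalHom V (ringClassField K ι (3 * m)) σ y) := by
      rw [hcomp, hcomp, hσσ']
    simp only [map_sub, map_zsmul, h1, h2, smul_sub]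
    abel
  -- `Ψ(σ′ z) = u • σ′ (Ψ z)` (part 10 sign rule, `χ(σ′) = u`)
  have hΨσ' : ∀ P : (V.baseChange (ringClassField K ι (3 * m))).toAffine.Point,
      genusTransport W C₁ hC₁ CV hV hθ2 (pointGalHom V (ringClassField K ι (3 * m)) σ' P) =
        (u : ℤ) • pointGalHom W (ringClassField K ι (3 * m)) σ' (genusTransport W C₁ hC₁ CV hV hθ2 P) := by
    intro P
    rw [pointGalHom_apply, pointGalHom_apply]
    rcases Int.units_eq_one_or u with rfl | rfl
    · rw [Units.val_one, one_smul]
      exact (genusTransport_map_of_eq W C₁ hC₁ CV hV hθ2 hθ2 _ ((genusSign_eq_one_iff θ σ').mp hsgn) P).symm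
    · rw [Units.val_neg, Units.val_one, neg_smul, one_smul]
      exact neg_eq_iff_eq_neg.mp
        (genusTransport_map_of_eq_neg W C₁ hC₁ CV hV hθ2 hθ2 _ ((genusSign_eq_neg_one_iff hθ2 hθ σ').mp hsgn) P).symm
  -- `τ̃ (Ψ z) = −Ψ(τ̃ z) = (−ε u) • σ′(Ψ z) − Ψ(t − σ t)`
  have hτΨ : pointGalHom W (ringClassField K ι (3 * m)) τt (genusTransport W C₁ hC₁ CV hV hθ2 (y - pointGalHom V (ringClassField K ι (3 * m)) σ y)) =
      (-ε * (u : ℤ)) • pointGalHom W (ringClassField K ι (3 * m)) σ' (genusTransport W C₁ hC₁ CV hV hθ2 (y - pointGalHom V (ringClassField K ι (3 * m)) σ y)) -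
        genusTransport W C₁ hC₁ CV hV hθ2
          ((pointGalHom V (ringClassField K ι (3 * m)) τt y - ε • pointGalHom V (ringClassField K ι (3 * m)) σ' y) -
            pointGalHom V (ringClassField K ι (3 * m)) σ (pointGalHom V (ringClassField K ι (3 * m)) τt y - ε • pointGalHom V (ringClassField K ι (3 * m)) σ' y)) := by
    have A : pointGalHom W (ringClassField K ι (3 * m)) τt (genusTransport W C₁ hC₁ CV hV hθ2 (y - pointGalHom V (ringClassField K ι (3 * m)) σ y)) =
        -genusTransport W C₁ hC₁ CV hV hθ2 (pointGalHom V (ringClassField K ι (3 * m)) τt (y - pointGalHom V (ringClassField K ι (3 * m)) σ y)) := by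
      rw [pointGalHom_apply, pointGalHom_apply]
      exact genusTransport_map_of_eq_neg W C₁ hC₁ CV hV hθ2 hθ2 _ hτθ _
    rw [A, hτz, genusTransport_add, genusTransport_zsmul, hΨσ', smul_smul, neg_mul, neg_smul]
    abel
  -- descend: `Ψ z = D↑`, `τ̃ (D↑) = (τ_m D)↑`, `σ′ (D↑) = (res σ′ D)↑`
  have hDτ := map_inclusion_pointGalHom_conj W ι hle hτm hτt D
  have hDσ := map_inclusion_pointGalHom_res W hK ι hm hle hres ⟨σ', hσ'G⟩ D
  rw [hD] at hDτ hDσ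
  refine ⟨res ⟨σ', hσ'G⟩, restrictHom_mem_ringClassGal ι hres _, ?_⟩
  -- the torsion statement upstairs, then downstairs by injectivity
  have htors : IsOfFinAddOrder (genusTransport W C₁ hC₁ CV hV hθ2
      ((pointGalHom V (ringClassField K ι (3 * m)) τt y - ε • pointGalHom V (ringClassField K ι (3 * m)) σ' y) -
        pointGalHom V (ringClassField K ι (3 * m)) σ (pointGalHom V (ringClassField K ι (3 * m)) τt y - ε • pointGalHom V (ringClassField K ι (3 * m)) σ' y))) := by
    refine (isOfFinAddOrder_genusTransport_iff' W C₁ hC₁ CV hV hθ2 _).mpr ?_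
    rw [sub_eq_add_neg]
    exact htor.add ((pointGalHom V (ringClassField K ι (3 * m)) σ).isOfFinAddOrder htor).neg
  have hup : Affine.Point.map ((RingClassField.inclusion ι hle).restrictScalars ℚ)
      (pointGalHom W (ringClassField K ι m) τm D - (-ε * (u : ℤ)) • pointGalHom W (ringClassField K ι m) (res ⟨σ', hσ'G⟩) D) =
      -genusTransport W C₁ hC₁ CV hV hθ2
        ((pointGalHom V (ringClassField K ι (3 * m)) τt y - ε • pointGalHom V (ringClassField K ι (3 * m)) σ' y) -
          pointGalHom V (ringClassField K ι (3 * m)) σ (pointGalHom V (ringClassField K ι (3 * m)) τt y - ε • pointGalHom V (ringClassField K ι (3 * m)) σ' y)) := by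
    rw [map_sub, map_zsmul, hDτ, hDσ, hτΨ]
    abel
  have hone : IsOfFinAddOrder
      (pointGalHom W (ringClassField K ι m) τm D - (-ε * (u : ℤ)) • pointGalHom W (ringClassField K ι m) (res ⟨σ', hσ'G⟩) D) := by
    rw [← (map_inclusion_injective' W ι hle).isOfFinAddOrder_iff
      (f := Affine.Point.map (W' := W) ((RingClassField.inclusion ι hle).restrictScalars ℚ)), hup]
    exact htors.neg
  have hc : pointGalHom W (ringClassField K ι m) τm (c • D) -
      (-ε * (u : ℤ)) • pointGalHom W (ringClassField K ι m) (res ⟨σ', hσ'G⟩) (c • D) =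
      c • (pointGalHom W (ringClassField K ι m) τm D - (-ε * (u : ℤ)) • pointGalHom W (ringClassField K ι m) (res ⟨σ', hσ'G⟩) D) := by
    rw [map_zsmul, map_zsmul, smul_sub, smul_comm]
  rw [hc]
  exact hone.zsmul

end B3

end Summit.BirchSwinnertonDyer.BirchSwinnertonDyer.Theorems.LeafPartnerGenusLabelB3

end
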